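import Mathlib
import Literature.NumberTheory.Transcendental.KZCalculus
import Literature.NumberTheory.Transcendental.KZCalculusProofs
import Literature.NumberTheory.Transcendental.SemialgebraicMaps
import Literature.NumberTheory.Transcendental.KZSemialgebraicComplex
import Summits.KontsevichZagierPeriods.KontsevichZagierPeriods.Theorems.InverseLandauTateLiftingPullback

/-!
# `TateLifting` (stmt-KontsevichZagierPeriods-9129), line `Sketch` — stub 66 `InversionChart`:
# the inversion engine

Unbounded fibres and cusps enter the Kontsevich–Zagier calculus through ONE rule-(2) move
(`KZ.changeOfVariablesRel`), the inversion of the last coordinate over `{z_last > 0}`,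
`Φ(z) = update z last (z last)⁻¹`, with Jacobian `|det Φ'(z)| = 1/(z last)²`. For a
representation `r = [σ, f]` in dimension `n + 1` with `σ ⊆ {x_last > 0}` the pulled-back
representation `r' = [D, f(Φ z)/(z last)²]`, `D = {z | z last > 0, Φ z ∈ σ}`, is honest and
`[r] − [r'] ∈ KZ.relations` (`tateLifting_inversionChart`). The honesty obligations and the move
are those of the landed pull-back engine `tateLifting_pullback`; this file supplies its seven side
inputs for the inversion:

* `Φ` is an involution (`InversionChart.chart_chart`), hence injective, and — since
  `σ ⊆ {x_last > 0}` — it maps `D` ONTO `σ` and `σ` ONTO `D` (`InversionChart.image_chart`,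
  `InversionChart.chart_image`);
* `Φ` is a `ℚ`-semialgebraic map on every `ℚ`-semialgebraic set missing `{z last = 0}`
  (coordinates and the inverse of a non-vanishing coordinate, `IsSemialgebraicFunOn.inv`), so
  `D = Φ(σ)` is `ℚ`-semialgebraic (Tarski–Seidenberg image theorem
  `IsSemialgebraicMapOn.isSemialgebraic_image_holds`);
* `Φ` has derivative the diagonal map `diag(1, …, 1, −(z last)⁻²)` at every `z` with `z last ≠ 0`
  (`InversionChart.hasFDerivAt_chart`), of absolute determinant `(z last ^ 2)⁻¹`
  (`InversionChart.abs_det_jac`), a `ℚ`-semialgebraic function on `D`.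

References: M. Kontsevich, D. Zagier, *Periods* (2001), §1.2 rule (2); J. Bochnak, M. Coste,
M.-F. Roy, *Real Algebraic Geometry* (1998), §2.2 (Prop. 2.2.6, 2.2.7).
-/

noncomputable section

open MeasureTheory Set
open Literature.NumberTheory.Transcendental
open Literature.ModelTheory.ExponentialFields (IsSemialgebraic)
open MvPolynomial (X)

namespace Summit.KontsevichZagierPeriods.InverseLandau

namespace InversionChart

variable {n : ℕ}

/-- The inversion chart inverts the last coordinate: `Φ(z)_last = (z last)⁻¹`. [folklore] -/
theorem chart_last (z : Fin (n + 1) → ℝ) :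
    Function.update z (Fin.last n) (z (Fin.last n))⁻¹ (Fin.last n) = (z (Fin.last n))⁻¹ :=
  Function.update_self _ _ _

/-- The inversion chart is an involution of `ℝⁿ⁺¹` (with Mathlib's `0⁻¹ = 0`): `Φ (Φ z) = z`.
[folklore] -/
theorem chart_chart (z : Fin (n + 1) → ℝ) :
    Function.update (Function.update z (Fin.last n) (z (Fin.last n))⁻¹) (Fin.last n)
        (Function.update z (Fin.last n) (z (Fin.last n))⁻¹ (Fin.last n))⁻¹ = z := by
  rw [Function.update_self, inv_inv, Function.update_idem, Function.update_eq_self]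

/-- The inversion chart is injective on every set (it is an involution). [folklore] -/
theorem injOn_chart (s : Set (Fin (n + 1) → ℝ)) :
    InjOn (fun z : Fin (n + 1) → ℝ => Function.update z (Fin.last n) (z (Fin.last n))⁻¹) s := by
  intro x _ y _ hxy
  have h :=
    congrArg (fun z : Fin (n + 1) → ℝ => Function.update z (Fin.last n) (z (Fin.last n))⁻¹) hxy
  simpa only [chart_chart] using h

/-- For `σ ⊆ {x_last > 0}` the inversion chart maps `D = {z | z last > 0, Φ z ∈ σ}` ONTO `σ`
(`x = Φ (Φ x)`). [folklore] -/
theorem image_chart {σ : Set (Fin (n + 1) → ℝ)} (hσ : ∀ x ∈ σ, 0 < x (Fin.last n)) :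
    (fun z : Fin (n + 1) → ℝ => Function.update z (Fin.last n) (z (Fin.last n))⁻¹) ''
        {z | 0 < z (Fin.last n) ∧ Function.update z (Fin.last n) (z (Fin.last n))⁻¹ ∈ σ} = σ := by
  ext x
  constructor
  · rintro ⟨z, hz, rfl⟩
    exact hz.2
  · intro hx
    refine ⟨Function.update x (Fin.last n) (x (Fin.last n))⁻¹, ⟨?_, ?_⟩, chart_chart x⟩
    · rw [chart_last]
      exact inv_pos.2 (hσ x hx)
    · show Function.update (Function.update x (Fin.last n) (x (Fin.last n))⁻¹) (Fin.last n)
        (Function.update x (Fin.last n) (x (Fin.last n))⁻¹ (Fin.last n))⁻¹ ∈ σ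
      rw [chart_chart]
      exact hx

/-- For `σ ⊆ {x_last > 0}` the inversion chart maps `σ` ONTO `D = {z | z last > 0, Φ z ∈ σ}`.
[folklore] -/
theorem chart_image {σ : Set (Fin (n + 1) → ℝ)} (hσ : ∀ x ∈ σ, 0 < x (Fin.last n)) :
    (fun z : Fin (n + 1) → ℝ => Function.update z (Fin.last n) (z (Fin.last n))⁻¹) '' σ =
      {z | 0 < z (Fin.last n) ∧ Function.update z (Fin.last n) (z (Fin.last n))⁻¹ ∈ σ} := by
  ext z
  constructor
  · rintro ⟨x, hx, rfl⟩
    refine ⟨?_, ?_⟩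
    · show 0 < Function.update x (Fin.last n) (x (Fin.last n))⁻¹ (Fin.last n)
      rw [chart_last]
      exact inv_pos.2 (hσ x hx)
    · show Function.update (Function.update x (Fin.last n) (x (Fin.last n))⁻¹) (Fin.last n)
        (Function.update x (Fin.last n) (x (Fin.last n))⁻¹ (Fin.last n))⁻¹ ∈ σ
      rw [chart_chart]
      exact hx
  · intro hz
    exact ⟨Function.update z (Fin.last n) (z (Fin.last n))⁻¹, hz.2, chart_chart z⟩

/-- The inversion chart is a `ℚ`-semialgebraic map on every `ℚ`-semialgebraic set missing the
hyperplane `{z last = 0}`: its coordinates are coordinate functions and the inverse of the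
non-vanishing last coordinate (`IsSemialgebraicFunOn.inv`, graph elimination).
[cite: BochnakCosteRoy1998, Prop. 2.2.6] -/
theorem isSemialgebraicMapOn_chart {s : Set (Fin (n + 1) → ℝ)} (hs : IsSemialgebraic ℚ s)
    (h0 : ∀ z ∈ s, z (Fin.last n) ≠ 0) :
    IsSemialgebraicMapOn ℚ s
      (fun z : Fin (n + 1) → ℝ => Function.update z (Fin.last n) (z (Fin.last n))⁻¹) := by
  refine IsSemialgebraicMapOn.of_forall hs fun j => ?_
  have happly : ∀ i : Fin (n + 1), IsSemialgebraicFunOn ℚ s (fun z => z i) := fun i => by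
    simpa using isSemialgebraicFunOn_aeval hs (X i : MvPolynomial (Fin (n + 1)) ℚ)
  by_cases hj : j = Fin.last n
  · subst hj
    simp only [Function.update_self]
    exact (happly (Fin.last n)).inv h0
  · simp only [Function.update_of_ne hj]
    exact happly j

/-- The source domain `D = {z | z last > 0, Φ z ∈ σ}` of the inversion move is `ℚ`-semialgebraic for
`ℚ`-semialgebraic `σ ⊆ {x_last > 0}`: it is the image `Φ(σ)` of `σ` under the `ℚ`-semialgebraic map
`Φ` (Tarski–Seidenberg image theorem). [cite: BochnakCosteRoy1998, Prop. 2.2.7] -/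
theorem isSemialgebraic_source {σ : Set (Fin (n + 1) → ℝ)} (hσsa : IsSemialgebraic ℚ σ)
    (hσ : ∀ x ∈ σ, 0 < x (Fin.last n)) :
    IsSemialgebraic ℚ
      {z : Fin (n + 1) → ℝ | 0 < z (Fin.last n) ∧
        Function.update z (Fin.last n) (z (Fin.last n))⁻¹ ∈ σ} := by
  rw [← chart_image hσ]
  exact IsSemialgebraicMapOn.isSemialgebraic_image_holds
    (isSemialgebraicMapOn_chart hσsa fun x hx => (hσ x hx).ne') Subset.rfl hσsa

/-- The Jacobian `diag(1, …, 1, −(z last)⁻²)` of the inversion chart has absolute determinant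
`(z last ^ 2)⁻¹` (determinant of a diagonal matrix). [folklore] -/
theorem abs_det_jac (z : Fin (n + 1) → ℝ) :
    |(LinearMap.toContinuousLinearMap (Matrix.toLin' (Matrix.diagonal fun i : Fin (n + 1) =>
        if i = Fin.last n then -(z (Fin.last n) ^ 2)⁻¹ else (1 : ℝ)))).det| =
      (z (Fin.last n) ^ 2)⁻¹ := by
  rw [LinearMap.det_toContinuousLinearMap, LinearMap.det_toLin', Matrix.det_diagonal,
    Finset.prod_ite_eq']
  simp [abs_inv]

/-- The inversion chart has derivative the diagonal map `diag(1, …, 1, −(z last)⁻²)` at every `z`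
with `z last ≠ 0` (coordinatewise: `hasFDerivAt_apply`, and `hasDerivAt_inv` composed with the
last projection). [folklore] -/
theorem hasFDerivAt_chart {z : Fin (n + 1) → ℝ} (hz : z (Fin.last n) ≠ 0) :
    HasFDerivAt (fun x : Fin (n + 1) → ℝ => Function.update x (Fin.last n) (x (Fin.last n))⁻¹)
      (LinearMap.toContinuousLinearMap (Matrix.toLin' (Matrix.diagonal fun i : Fin (n + 1) =>
        if i = Fin.last n then -(z (Fin.last n) ^ 2)⁻¹ else (1 : ℝ)))) z := by
  rw [hasFDerivAt_pi']
  intro i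
  have happly : ∀ j : Fin (n + 1), HasFDerivAt (fun x : Fin (n + 1) → ℝ => x j)
      (ContinuousLinearMap.proj (R := ℝ) (φ := fun _ : Fin (n + 1) => ℝ) j) z :=
    fun j => hasFDerivAt_apply j z
  by_cases hi : i = Fin.last n
  · subst hi
    simp only [Function.update_self]
    refine ((hasDerivAt_inv hz).comp_hasFDerivAt z (happly (Fin.last n))).congr_fderiv
      (ContinuousLinearMap.ext fun v => ?_)
    simp [Matrix.mulVec_diagonal]
  · simp only [Function.update_of_ne hi]
    refine (happly i).congr_fderiv (ContinuousLinearMap.ext fun v => ?_)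
    simp [Matrix.mulVec_diagonal, hi]

/-- The Jacobian factor `z ↦ (z last ^ 2)⁻¹` is a `ℚ`-semialgebraic function on the source domain
`D ⊆ {z last > 0}` (inverse of a non-vanishing polynomial).
[cite: BochnakCosteRoy1998, Prop. 2.2.6] -/
theorem isSemialgebraicFunOn_jacobian {D : Set (Fin (n + 1) → ℝ)} (hD : IsSemialgebraic ℚ D)
    (h0 : ∀ z ∈ D, 0 < z (Fin.last n)) :
    IsSemialgebraicFunOn ℚ D (fun z => (z (Fin.last n) ^ 2)⁻¹) := by
  have hsq := isSemialgebraicFunOn_aeval hD (X (Fin.last n) ^ 2 : MvPolynomial (Fin (n + 1)) ℚ)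
  simp only [map_pow, MvPolynomial.aeval_X] at hsq
  exact hsq.inv fun z hz => pow_ne_zero 2 (h0 z hz).ne'

end InversionChart

/-- **THE INVERSION ENGINE** (stub 66 of line `Sketch`): for a representation `r = [σ, f]` of
dimension `n + 1` with `σ ⊆ {x_last > 0}`, the pull-back along the inversion of the last
coordinate `Φ(z) = update z last (z last)⁻¹` is an honest representation `r'` with domain
`D = {z | z last > 0, Φ z ∈ σ}` and integrand `f(Φ z)/(z last)²` on `D`, and
`[r] − [r'] ∈ KZ.relations`: ONE change of variables (Kontsevich–Zagier's rule (2),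
`KZ.changeOfVariablesRel`) from `r'` onto `r` — `Φ` is `ℚ`-semialgebraic and injective on `D` with
`Φ(D) = σ`, differentiable with `|det Φ'(z)| = (z last)⁻²`, and the pull-back is absolutely
integrable by Mathlib's Jacobian criterion
(`MeasureTheory.integrableOn_image_iff_integrableOn_abs_det_fderiv_smul`, packaged in
`tateLifting_pullback`). [cite: KontsevichZagier2001, §1.2 rule (2)] -/
theorem tateLifting_inversionChart :
    ∀ (n : ℕ) (r : KZ.IntegralRep (n + 1)), (∀ x ∈ r.domain, 0 < x (Fin.last n)) →
    ∃ r' : KZ.IntegralRep (n + 1),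
      r'.domain = {z | 0 < z (Fin.last n) ∧ Function.update z (Fin.last n) (z (Fin.last n))⁻¹ ∈ r.domain} ∧
      Set.EqOn r'.integrand
        (fun z => r.integrand (Function.update z (Fin.last n) (z (Fin.last n))⁻¹) / z (Fin.last n) ^ 2) r'.domain ∧
      KZ.of r - KZ.of r' ∈ KZ.relations := by
  intro n r hpos
  have hD : IsSemialgebraic ℚ {z : Fin (n + 1) → ℝ | 0 < z (Fin.last n) ∧
      Function.update z (Fin.last n) (z (Fin.last n))⁻¹ ∈ r.domain} :=
    InversionChart.isSemialgebraic_source r.isSemialgebraic_domain hpos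
  obtain ⟨r', hdom, hint, hrel⟩ := tateLifting_pullback (n + 1) r
    {z | 0 < z (Fin.last n) ∧ Function.update z (Fin.last n) (z (Fin.last n))⁻¹ ∈ r.domain}
    (fun z => Function.update z (Fin.last n) (z (Fin.last n))⁻¹)
    (fun z => LinearMap.toContinuousLinearMap (Matrix.toLin' (Matrix.diagonal
      fun i : Fin (n + 1) => if i = Fin.last n then -(z (Fin.last n) ^ 2)⁻¹ else (1 : ℝ))))
    (fun z => (z (Fin.last n) ^ 2)⁻¹) hD
    (InversionChart.isSemialgebraicMapOn_chart hD fun z hz => hz.1.ne')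
    (fun z hz => (InversionChart.hasFDerivAt_chart hz.1.ne').hasFDerivWithinAt)
    (InversionChart.injOn_chart _) (InversionChart.image_chart hpos)
    (InversionChart.isSemialgebraicFunOn_jacobian hD fun z hz => hz.1)
    (fun z _ => (InversionChart.abs_det_jac z).symm)
  refine ⟨r', hdom, fun z _ => ?_, hrel⟩
  rw [hint]
  exact (div_eq_inv_mul _ _).symm

end Summit.KontsevichZagierPeriods.InverseLandau

end
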